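import Summits.BirchSwinnertonDyer.BirchSwinnertonDyer.Theses.KolyvaginRankRigidityAtTwo
import Summits.BirchSwinnertonDyer.BirchSwinnertonDyer.Theorems.KolyvaginRankRigidityAtTwoOffHabitatIrredNonSurjTwoConverseNoTwoTorsionOverKOfIrred
import Summits.BirchSwinnertonDyer.BirchSwinnertonDyer.Theorems.KolyvaginRankRigidityAtTwoOffHabitatIrredCorankLowerBoundAtTwoRich
import Summits.BirchSwinnertonDyer.BirchSwinnertonDyer.Theorems.KolyvaginRankRigidityAtTwoOffHabitatIrredFullClassDeepeningAtTwo

/-!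
# LINE 8∞ draft for R_irr `OffHabitatIrredNonSurjTwoConverse` (stmt-BirchSwinnertonDyer-27123) — ∞-form re-lining

Pen bsd-idea-1 g7 DRAFT (evidence only; this seat cannot `crux write` / register — W-79; the registrar is the
27123 seat / next KRR LEAD).  Mirrors the habitat kernel V1′∞ 27983 / V2♭∞ 27984 (and U1 28083 / U2 28084 one
level down) with the habitat binder `(∀ m, ρ_{E,2^m} onto)` replaced by R_irr's frame
`¬ (∀ m, onto) ∧ E(ℚ)[2] = 0`; the composition replays the route's `closes` (r = 0 BFH-partner branch and
r = 1 branch) verbatim, with `NoTwoTorsionOverK` replaced by the LANDED off-habitat stub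
`KolyvaginRankRigidity.stub_noTwoTorsionOverK_of_irred` (p634161).  Printed-input items enter BY NAME as
hypotheses of the composition (existing route items 23951, 25006, 19921, …), exactly as in `closes`.
Open organ after re-threading (krr2-p2 OFFHABITAT-KERNEL-g9): U1irr = Kolyvagin's Conjecture A at 2 on
y_K-torsion frames off the surjective habitat; U2irr / V2irr are re-threading of the landed suppliers modulo
print item 23091 (Gross 3.7(2)) and Serre's open image (named fact).  Nothing here is proved about BSD; the two
stubs are `sorry`.
REGISTRAR: krr2-p2 WIDTH g9 (write_crux ACL (217)): added `set_option linter.dupNamespace false`, the cite-only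
`stub_printedInputs` and the zero-hypothesis by-name composition `offHabitatIrredNonSurjTwoConverse_of` (critic #127 price (1)).
RESHAPE (krr2-p2 WIDTH g10, 2026-08-28): V2irr and U2irr are LANDED modulo print —
`KolyvaginLowerBoundAtTwo.corankLowerBoundAtTwoRichIrr_of_prop37` / `…fullClassDeepeningAtTwoIrr_of_prop37` /
`…strongNonzeroSystemAtTwoIrr_of_boundedDefectIrr` (Theorems, `--supports` 27123; re-threading of the habitat ∞-engine
through the off-habitat suppliers).  So `stub_corankLowerBoundAtTwoRichIrr` and `stub_strongNonzeroSystemAtTwoIrr` are now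
THEOREMS of this file from the registered stubs `stub_boundedDefectAtTwoIrr` (U1irr — the organ: Kolyvagin's Conjecture A
at 2 with bounded defect, off habitat; OPEN), `stub_prop37_2` (print item 23091, Gross 1991 Prop. 3.7 (2)) and
`stub_serreOpenImage` (Serre's open image theorem, named fact `serre_adicImage_contains_congruenceSubgroup`), plus the
cite-only `stub_printedInputs`.  Open content of the line = U1irr + print.  Nothing here is proved about BSD.
-/

set_option autoImplicit false
-- the Cruxes namespace of this sub repeats the summit name by design (D-0017 nested layout)
set_option linter.dupNamespace false
open scoped Classical

namespace Summit.BirchSwinnertonDyer.BirchSwinnertonDyer.Cruxes.OffHabitatIrredNonSurjTwoConverse.KolyvaginDepthSplitInfIrr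
open Summit.BirchSwinnertonDyer.BirchSwinnertonDyer.Theses.KolyvaginRankRigidityAtTwo

/-- V1irr = V1′∞ (27983 `KolyvaginStrongNonzeroSystemAtTwo`) on R_irr's frame. -/
def StrongNonzeroSystemAtTwoIrr : Prop :=
  ∀ (W : WeierstrassCurve ℚ) [W.IsElliptic] [W.IsGloballyMinimal], ¬ W.HasCM → (Literature.NumberTheory.EllipticCurves.Rank1Residual.GoodOrd W 2 ∨ Literature.NumberTheory.EllipticCurves.Rank1Residual.Mult W 2) → ¬ (∀ m : ℕ, W.HasSurjectiveModNGaloisRep (2 ^ m : ℕ)) → AddSubgroup.torsionBy W.toAffine.Point (2 : ℤ) = ⊥ → ∀ (K : Type) [Field K] [NumberField K], Literature.NumberTheory.EllipticCurves.IsImaginaryQuadratic K → ∀ [NeZero (W.conductorNorm ℤ)], Literature.NumberTheory.EllipticCurves.SatisfiesHeegnerHypothesis (W.conductorNorm ℤ) K → Odd (NumberField.discr K) → NumberField.discr K ≠ -3 → AddSubgroup.torsionBy (W.baseChange K).toAffine.Point (2 : ℤ) = ⊥ → Literature.NumberTheory.EllipticCurves.SatisfiesHeegnerHypothesis 2 K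 → ∀ (Dt : Literature.NumberTheory.EllipticCurves.ModularForms.ModularParametrizationData W (W.conductorNorm ℤ)) (β : ℤ) (ι : K →+* ℂ), (4 * (W.conductorNorm ℤ : ℤ)) ∣ β ^ 2 - NumberField.discr K → ∃ r : ℕ, ∀ θ k : ℕ, ∃ (n : ℕ) (d : Literature.NumberTheory.EllipticCurves.KolyvaginHeegnerData Dt β ι n) (M : ℕ), Literature.NumberTheory.EllipticCurves.KolyvaginDescent.KolSupp (Literature.NumberTheory.EllipticCurves.Zhang2014.IsKolyvaginPrime (W.conductorNorm ℤ) W K 2) n ∧ n.primeFactors.card = r ∧ 1 ≤ M ∧ ((θ * M + k : ℕ) : ℕ∞) ≤ Literature.NumberTheory.EllipticCurves.Zhang2014.levelIndex W 2 n ∧ d.kolyvaginClass Nat.prime_two M ≠ 0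

/-- V2irr = V2♭∞ (27984 `KolyvaginCorankLowerBoundAtTwoRich`) on R_irr's frame. -/
def CorankLowerBoundAtTwoRichIrr : Prop :=
  ∀ (W : WeierstrassCurve ℚ) [W.IsElliptic] [W.IsGloballyMinimal], ¬ W.HasCM → (Literature.NumberTheory.EllipticCurves.Rank1Residual.GoodOrd W 2 ∨ Literature.NumberTheory.EllipticCurves.Rank1Residual.Mult W 2) → ¬ (∀ m : ℕ, W.HasSurjectiveModNGaloisRep (2 ^ m : ℕ)) → AddSubgroup.torsionBy W.toAffine.Point (2 : ℤ) = ⊥ → ∀ (K : Type) [Field K] [NumberField K], Literature.NumberTheory.EllipticCurves.IsImaginaryQuadratic K → NumberField.discr K ≠ -3 → NumberField.discr K ≠ -4 → ¬ ((2 : ℤ) ∣ NumberField.discr K) → ∀ [NeZero (W.conductorNorm ℤ)], Literature.NumberTheory.EllipticCurves.SatisfiesHeegnerHypothesis (W.conductorNorm ℤ) K → ∀ (Dt : Literature.NumberTheory.EllipticCurves.ModularForms.ModularParametrizationData W (W.conductorNorm ℤ)) (β : ℤ) (ι : K →+* ℂ) (ν : ℕ), (∀ θ k : ℕ, ∃ (n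 : ℕ) (d : Literature.NumberTheory.EllipticCurves.KolyvaginHeegnerData Dt β ι n) (M : ℕ), Literature.NumberTheory.EllipticCurves.KolyvaginDescent.KolSupp (Literature.NumberTheory.EllipticCurves.Zhang2014.IsKolyvaginPrime (W.conductorNorm ℤ) W K 2) n ∧ n.primeFactors.card = ν ∧ 1 ≤ M ∧ ((θ * M + k : ℕ) : ℕ∞) ≤ Literature.NumberTheory.EllipticCurves.Zhang2014.levelIndex W 2 n ∧ d.kolyvaginClass Nat.prime_two M ≠ 0) → (∀ ν' : ℕ, ν' < ν → ∃ θ k : ℕ, ∀ (n' : ℕ) (d' : Literature.NumberTheory.EllipticCurves.KolyvaginHeegnerData Dt β ι n') (M' : ℕ), Literature.NumberTheory.EllipticCurves.KolyvaginDescent.KolSupp (Literature.NumberTheory.EllipticCurves.Zhang2014.IsKolyvaginPrime (W.conductorNorm ℤ) W K 2) n' → 1 ≤ M' → ((θ * M' + k : ℕ) : ℕ∞) ≤ Literature.NumberTheory.EllipticCurves.Zhang2014.levelIndex W 2 n' → n'.primeFactors.card = ν' → d'.kolyvaginClass Nat.prime_two M' = 0) → (ν + 1 ≤ W.selmerCorank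 2 ∨ ν + 1 ≤ (W.quadraticTwist (NumberField.discr K : ℚ)).selmerCorank 2)

/-- U1irr = U1 (28083 `KolyvaginBoundedDefectAtTwo`, the organ: Conj A at 2 with bounded defect) on R_irr's frame. -/
def BoundedDefectAtTwoIrr : Prop :=
  ∀ (W : WeierstrassCurve ℚ) [W.IsElliptic] [W.IsGloballyMinimal], ¬ W.HasCM → (Literature.NumberTheory.EllipticCurves.Rank1Residual.GoodOrd W 2 ∨ Literature.NumberTheory.EllipticCurves.Rank1Residual.Mult W 2) → ¬ (∀ m : ℕ, W.HasSurjectiveModNGaloisRep (2 ^ m : ℕ)) → AddSubgroup.torsionBy W.toAffine.Point (2 : ℤ) = ⊥ → ∀ (K : Type) [Field K] [NumberField K], Literature.NumberTheory.EllipticCurves.IsImaginaryQuadratic K → ∀ [NeZero (W.conductorNorm ℤ)], Literature.NumberTheory.EllipticCurves.SatisfiesHeegnerHypothesis (W.conductorNorm ℤ) K → Odd (NumberField.discr K) → NumberField.discr K ≠ -3 → AddSubgroup.torsionBy (W.baseChange K).toAffine.Point (2 : ℤ) = ⊥ → Literature.NumberTheory.EllipticCurves.SatisfiesHeegnerHypothesis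 2 K → ∀ (Dt : Literature.NumberTheory.EllipticCurves.ModularForms.ModularParametrizationData W (W.conductorNorm ℤ)) (β : ℤ) (ι : K →+* ℂ), (4 * (W.conductorNorm ℤ : ℤ)) ∣ β ^ 2 - NumberField.discr K → ∃ r m : ℕ, ∀ M : ℕ, m < M → ∃ (n : ℕ) (d : Literature.NumberTheory.EllipticCurves.KolyvaginHeegnerData Dt β ι n), Literature.NumberTheory.EllipticCurves.KolyvaginDescent.KolSupp (Literature.NumberTheory.EllipticCurves.Zhang2014.IsKolyvaginPrime (W.conductorNorm ℤ) W K 2) n ∧ n.primeFactors.card = r ∧ ((M : ℕ) : ℕ∞) ≤ Literature.NumberTheory.EllipticCurves.Zhang2014.levelIndex W 2 n ∧ (2 ^ (M - m - 1) : ℤ) • d.kolyvaginClass Nat.prime_two M ≠ 0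

/-- U2irr = U2 (28084 `FullClassDeepeningAtTwo`) on R_irr's frame (re-threading: Sah bit → inflation defect k). -/
def FullClassDeepeningAtTwoIrr : Prop :=
  ∀ (W : WeierstrassCurve ℚ) [W.IsElliptic] [W.IsGloballyMinimal], ¬ W.HasCM → (Literature.NumberTheory.EllipticCurves.Rank1Residual.GoodOrd W 2 ∨ Literature.NumberTheory.EllipticCurves.Rank1Residual.Mult W 2) → ¬ (∀ m : ℕ, W.HasSurjectiveModNGaloisRep (2 ^ m : ℕ)) → AddSubgroup.torsionBy W.toAffine.Point (2 : ℤ) = ⊥ → ∀ (K : Type) [Field K] [NumberField K], Literature.NumberTheory.EllipticCurves.IsImaginaryQuadratic K → ∀ [NeZero (W.conductorNorm ℤ)], Literature.NumberTheory.EllipticCurves.SatisfiesHeegnerHypothesis (W.conductorNorm ℤ) K → Odd (NumberField.discr K) → NumberField.discr K ≠ -3 → AddSubgroup.torsionBy (W.baseChange K).toAffine.Point (2 : ℤ) = ⊥ → Literature.NumberTheory.EllipticCurves.SatisfiesHeegnerHypothesis 2 K → ∀ (Dt : Literature.NumberTheory.EllipticCurves.ModularForms.ModularParametrizationData W (W.conductorNorm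 ℤ)) (β : ℤ) (ι : K →+* ℂ), (4 * (W.conductorNorm ℤ : ℤ)) ∣ β ^ 2 - NumberField.discr K → ∃ c : ℕ, ∀ (θ k r m M n : ℕ) (d : Literature.NumberTheory.EllipticCurves.KolyvaginHeegnerData Dt β ι n), Literature.NumberTheory.EllipticCurves.KolyvaginDescent.KolSupp (Literature.NumberTheory.EllipticCurves.Zhang2014.IsKolyvaginPrime (W.conductorNorm ℤ) W K 2) n → n.primeFactors.card = r → ((M : ℕ) : ℕ∞) ≤ Literature.NumberTheory.EllipticCurves.Zhang2014.levelIndex W 2 n → c * (m + r + 1) ≤ M → (2 ^ (M - m - 1) : ℤ) • d.kolyvaginClass Nat.prime_two M ≠ 0 → ∃ (n' : ℕ) (d' : Literature.NumberTheory.EllipticCurves.KolyvaginHeegnerData Dt β ι n') (M' : ℕ), Literature.NumberTheory.EllipticCurves.KolyvaginDescent.KolSupp (Literature.NumberTheory.EllipticCurves.Zhang2014.IsKolyvaginPrime (W.conductorNorm ℤ) W K 2) n' ∧ n'.primeFactors.card = r ∧ 1 ≤ M' ∧ ((θ * M' + k : ℕ) : ℕ∞) ≤ Literature.NumberTheory.EllipticCurves.Zhang2014.levelIndex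 W 2 n' ∧ d'.kolyvaginClass Nat.prime_two M' ≠ 0

abbrev stub_strongNonzeroSystemAtTwoIrr_statement : Prop := StrongNonzeroSystemAtTwoIrr
abbrev stub_corankLowerBoundAtTwoRichIrr_statement : Prop := CorankLowerBoundAtTwoRichIrr

/-- STUB U1irr (the ORGAN: Kolyvagin's Conjecture A at `2` with bounded defect on y_K-torsion frames, off the surjective
habitat; OPEN — same open problem as U1 28083 on a larger class of curves). -/
theorem stub_boundedDefectAtTwoIrr : BoundedDefectAtTwoIrr := by
  sorry

/-- STUB (cite-only PRINT input: Gross 1991 Prop. 3.7 (2) = Nekovář 2007 Prop. 4.9, item stmt-BirchSwinnertonDyer-23091;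
the same registered text as `stub_prop37_2` of the 27984 skeleton). -/
theorem stub_prop37_2 : Literature.NumberTheory.EllipticCurves.GrossLMS1991.prop37_2_frobeniusCongruence := by
  sorry

/-- STUB (cite-only PRINT input: Serre's `2`-adic open image theorem for non-CM `E/ℚ`, congruence form — Silverman AEC
Thm. III.7.9 (a); named fact `serre_adicImage_contains_congruenceSubgroup`, no `_holds` in the tree). -/
theorem stub_serreOpenImage : Literature.NumberTheory.EllipticCurves.serre_adicImage_contains_congruenceSubgroup := by
  sorry

/-- V1irr from the U-split: U1irr (stub) + U2irr (LANDED modulo print, `fullClassDeepeningAtTwoIrr_of_prop37`) via the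
landed glue `strongNonzeroSystemAtTwoIrr_of_boundedDefectIrr` (krr2-p2 g10). Former stub; now a theorem of this file
modulo the registered stubs. -/
theorem strongNonzeroSystemAtTwoIrr_of_stubs : StrongNonzeroSystemAtTwoIrr :=
  Summit.BirchSwinnertonDyer.BirchSwinnertonDyer.Theorems.KolyvaginLowerBoundAtTwo.strongNonzeroSystemAtTwoIrr_of_boundedDefectIrr
    stub_prop37_2 stub_serreOpenImage stub_boundedDefectAtTwoIrr

/-- V2irr LANDED modulo print: `corankLowerBoundAtTwoRichIrr_of_prop37` (krr2-p2 g10; re-threading of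
`KolyvaginCorankLowerBoundAtTwoRich_of_prop37` through the off-habitat suppliers). Former stub; now a theorem of this
file modulo the two print stubs. -/
theorem corankLowerBoundAtTwoRichIrr_of_stubs : CorankLowerBoundAtTwoRichIrr :=
  Summit.BirchSwinnertonDyer.BirchSwinnertonDyer.Theorems.KolyvaginLowerBoundAtTwo.corankLowerBoundAtTwoRichIrr_of_prop37
    stub_prop37_2 stub_serreOpenImage

/-- STUB (cite-only, printed inputs BY NAME — existing route items 23951, 25006, 25007, 19921, 19382, 19372, 19273;
the same conjunction as the registered `stub_printedInputs` of the θ-skeleton; never staffed). -/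
theorem stub_printedInputs : PrintedInputsRankOneAtTwo ∧ BFHTwistSupply ∧ SimpleZeroTwistSplitAtTwoOfBFH ∧
    MultPublishedInputsAtTwo ∧ NewformOfEllipticCurve ∧ HoffsteinLuoNonvanishingTwist ∧ EntireLFunctionRat := by
  sorry

/-- The composition with the inputs displayed as hypotheses (the route's `closes` replayed on R_irr's frame;
registrar krr2-p2 g9: renamed from the pen's `offHabitatIrredNonSurjTwoConverse_of`, which is now the
zero-hypothesis by-name form below). -/
theorem offHabitatIrredNonSurjTwoConverse_of_inputs (hV1 : stub_strongNonzeroSystemAtTwoIrr_statement)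
    (hV2 : stub_corankLowerBoundAtTwoRichIrr_statement)
    (hIn : PrintedInputsRankOneAtTwo)
    (hf : BFHTwistSupply) (h0 : SimpleZeroTwistSplitAtTwoOfBFH) (hGZK : MultPublishedInputsAtTwo)
    (hMod : NewformOfEllipticCurve) (hHLT : HoffsteinLuoNonvanishingTwist) (hEnt : EntireLFunctionRat) :
    OffHabitatIrredNonSurjTwoConverse := by
  have hBFH : SimpleZeroTwistSplitAtTwo := h0 hf
  intro W _ _ hCM hred r hr hc hns h2
  obtain ⟨-, -, hpar, hKato, -, hGZ, hrec⟩ := hIn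
  have hmod : Literature.NumberTheory.EllipticCurves.ModularForms.exists_isNewformOf := hMod
  have hHL : Literature.NumberTheory.EllipticCurves.HoffsteinLuo1997_exists_twist_L_one_ne_zero := hHLT
  have hE : WeierstrassCurve.hasEntireLFunction_rat := hEnt
  have hGZK' : Literature.NumberTheory.EllipticCurves.rank_eq_analyticRank_of_analyticRank_le_one := hGZK
  haveI : Fact (Nat.Prime 2) := ⟨Nat.prime_two⟩
  haveI : NeZero (W.conductorNorm ℤ) := ⟨(W.conductorNorm_pos_holds).ne'⟩
  obtain rfl | rfl : r = 0 ∨ r = 1 := by omega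
  · -- ===== r = 0 : partner twist with a simple zero (BFH 1990 (i), `2` split) =====
    have hw : W.rootNumber = 1 := by
      have h := hpar W
      unfold Literature.NumberTheory.EllipticCurves.p_parity at h
      rw [hc, pow_zero] at h
      exact h.symm
    obtain ⟨K, _, _, hK, -, hHN, hH2, hd8, hL0, hL1⟩ := hBFH W hw 0
    have hodd : Odd (NumberField.discr K) := by
      rw [Int.odd_iff]; omega
    have hne3 : NumberField.discr K ≠ -3 := by omega
    have hne4 : NumberField.discr K ≠ -4 := by omega
    have h2d : ¬ ((2 : ℤ) ∣ NumberField.discr K) := by omega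
    have hd : (NumberField.discr K : ℚ) ≠ 0 := by exact_mod_cast NumberField.discr_ne_zero K
    haveI := W.isElliptic_quadraticTwist hd
    have hr1 : (W.quadraticTwist (NumberField.discr K : ℚ)).analyticRank = 1 :=
      Literature.NumberTheory.EllipticCurves.analyticRank_eq_one_of_entireLFunction_one_eq_zero_of_deriv_ne_zero
        _ (hE _) hL0 hL1
    obtain ⟨hrk, hsha⟩ := hGZK' (W.quadraticTwist (NumberField.discr K : ℚ)) (le_of_eq hr1)
    rw [hr1] at hrk
    haveI := hsha
    have hc' : (W.quadraticTwist (NumberField.discr K : ℚ)).selmerCorank 2 = 1 :=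
      Literature.NumberTheory.EllipticCurves.selmerCorank_eq_one_of_mordellWeilRank_eq_one_of_finite
        (W.quadraticTwist (NumberField.discr K : ℚ)) 2 hrk inferInstance
    have htor := Summit.BirchSwinnertonDyer.BirchSwinnertonDyer.Theorems.KolyvaginRankRigidity.stub_noTwoTorsionOverK_of_irred W h2 K hK
    obtain ⟨fW, hfW⟩ := hMod W
    obtain ⟨Dt⟩ :=
      Literature.NumberTheory.Automorphic.nonempty_modularParametrizationData_of_isNewformOf hfW
    obtain ⟨β, hβ⟩ := Literature.NumberTheory.EllipticCurves.exists_dvd_sq_sub_discr_holds (W.conductorNorm ℤ) K hK hHN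
    obtain ⟨ι⟩ := (inferInstance : Nonempty (K →+* ℂ))
    obtain ⟨r, hr⟩ := hV1 W hCM hred hns h2 K hK hHN hodd hne3 htor hH2 Dt β ι hβ
    -- the least RICH depth `ν ≤ r`
    have hex : ∃ ν : ℕ, ∀ θ k : ℕ, ∃ (n : ℕ)
        (d : Literature.NumberTheory.EllipticCurves.KolyvaginHeegnerData Dt β ι n) (M : ℕ),
        Literature.NumberTheory.EllipticCurves.KolyvaginDescent.KolSupp
          (Literature.NumberTheory.EllipticCurves.Zhang2014.IsKolyvaginPrime (W.conductorNorm ℤ) W K 2) n ∧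
        n.primeFactors.card = ν ∧ 1 ≤ M ∧
        ((θ * M + k : ℕ) : ℕ∞) ≤ Literature.NumberTheory.EllipticCurves.Zhang2014.levelIndex W 2 n ∧
        d.kolyvaginClass Nat.prime_two M ≠ 0 := ⟨r, hr⟩
    have hrich := Nat.find_spec hex
    have hbelow : ∀ ν' : ℕ, ν' < Nat.find hex → ∃ θ k : ℕ, ∀ (n' : ℕ)
        (d' : Literature.NumberTheory.EllipticCurves.KolyvaginHeegnerData Dt β ι n') (M' : ℕ),
        Literature.NumberTheory.EllipticCurves.KolyvaginDescent.KolSupp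
          (Literature.NumberTheory.EllipticCurves.Zhang2014.IsKolyvaginPrime (W.conductorNorm ℤ) W K 2) n' →
        1 ≤ M' →
        ((θ * M' + k : ℕ) : ℕ∞) ≤ Literature.NumberTheory.EllipticCurves.Zhang2014.levelIndex W 2 n' →
        n'.primeFactors.card = ν' → d'.kolyvaginClass Nat.prime_two M' = 0 := by
      intro ν' hν'
      have h := Nat.find_min hex hν'
      rw [not_forall] at h
      obtain ⟨θ, h⟩ := h
      rw [not_forall] at h
      obtain ⟨k, hθk⟩ := h
      exact ⟨θ, k, fun n' d' M' hn' hM' hle hcard ↦ by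
        by_contra hne'; exact hθk ⟨n', d', M', hn', hcard, hM', hle, hne'⟩⟩
    -- the ONLY use of V2: the lower bound `ν + 1 ≤ max(c, c') = 1` forces `ν = 0`
    have hstruct := hV2 W hCM hred hns h2 K hK hne3 hne4 h2d hHN Dt β ι (Nat.find hex) hrich hbelow
    have hν : Nat.find hex = 0 := by
      rcases hstruct with h1 | h1 <;> omega
    rw [hν] at hrich
    obtain ⟨n₀, d₀, M₀, hn₀, hν0, hM₀, -, hne₀⟩ := hrich 0 0
    have hn1 : n₀ = 1 := by
      rw [Finset.card_eq_zero, Nat.primeFactors_eq_empty] at hν0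
      rcases hν0 with h0 | h1
      · exact absurd (h0 ▸ hn₀.1) not_squarefree_zero
      · exact h1
    subst hn1
    have hEK : Literature.NumberTheory.EllipticCurves.analyticRankEK W K = 1 :=
      Literature.NumberTheory.EllipticCurves.heegnerSystem_analyticRankEK_eq_one_of_kolyvaginClass_one_ne_zero
        (hGZ W _ K) (hrec _ W K) hK rfl hHN d₀ hne₀
    rw [Literature.NumberTheory.EllipticCurves.analyticRankEK_eq_add_of hE W K, hr1] at hEK
    omega
  · -- ===== r = 1 : partner twist with L(E^{(d_K)}, 1) ≠ 0 (Hoffstein–Luo) =====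
    have hw : W.rootNumber = -1 := by
      have h := hpar W
      unfold Literature.NumberTheory.EllipticCurves.p_parity at h
      rw [hc, pow_one] at h
      exact h.symm
    obtain ⟨K, _, _, hK, -, hHN, hH2, hd8, hL1⟩ :=
      Literature.NumberTheory.EllipticCurves.exists_heegnerField_split_twist_ne_zero_discr_emod_eight_of_hoffsteinLuo
        hmod hHL W hw Nat.prime_two 0
    have hodd : Odd (NumberField.discr K) := by
      rw [Int.odd_iff]; omega
    have hne3 : NumberField.discr K ≠ -3 := by omega
    have hne4 : NumberField.discr K ≠ -4 := by omega
    have h2d : ¬ ((2 : ℤ) ∣ NumberField.discr K) := by omega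
    have hd : (NumberField.discr K : ℚ) ≠ 0 := by exact_mod_cast NumberField.discr_ne_zero K
    haveI := W.isElliptic_quadraticTwist hd
    obtain ⟨-, -, hfin⟩ := hKato (W.quadraticTwist (NumberField.discr K : ℚ)) hL1
    haveI := hfin
    have hc' : (W.quadraticTwist (NumberField.discr K : ℚ)).selmerCorank 2 = 0 :=
      (W.quadraticTwist (NumberField.discr K : ℚ)).selmerCorank_eq_zero_of_finite 2
    have htor := Summit.BirchSwinnertonDyer.BirchSwinnertonDyer.Theorems.KolyvaginRankRigidity.stub_noTwoTorsionOverK_of_irred W h2 K hK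
    obtain ⟨fW, hfW⟩ := hMod W
    obtain ⟨Dt⟩ :=
      Literature.NumberTheory.Automorphic.nonempty_modularParametrizationData_of_isNewformOf hfW
    obtain ⟨β, hβ⟩ := Literature.NumberTheory.EllipticCurves.exists_dvd_sq_sub_discr_holds (W.conductorNorm ℤ) K hK hHN
    obtain ⟨ι⟩ := (inferInstance : Nonempty (K →+* ℂ))
    obtain ⟨r, hr⟩ := hV1 W hCM hred hns h2 K hK hHN hodd hne3 htor hH2 Dt β ι hβ
    -- the least RICH depth `ν ≤ r`
    have hex : ∃ ν : ℕ, ∀ θ k : ℕ, ∃ (n : ℕ)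
        (d : Literature.NumberTheory.EllipticCurves.KolyvaginHeegnerData Dt β ι n) (M : ℕ),
        Literature.NumberTheory.EllipticCurves.KolyvaginDescent.KolSupp
          (Literature.NumberTheory.EllipticCurves.Zhang2014.IsKolyvaginPrime (W.conductorNorm ℤ) W K 2) n ∧
        n.primeFactors.card = ν ∧ 1 ≤ M ∧
        ((θ * M + k : ℕ) : ℕ∞) ≤ Literature.NumberTheory.EllipticCurves.Zhang2014.levelIndex W 2 n ∧
        d.kolyvaginClass Nat.prime_two M ≠ 0 := ⟨r, hr⟩
    have hrich := Nat.find_spec hex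
    have hbelow : ∀ ν' : ℕ, ν' < Nat.find hex → ∃ θ k : ℕ, ∀ (n' : ℕ)
        (d' : Literature.NumberTheory.EllipticCurves.KolyvaginHeegnerData Dt β ι n') (M' : ℕ),
        Literature.NumberTheory.EllipticCurves.KolyvaginDescent.KolSupp
          (Literature.NumberTheory.EllipticCurves.Zhang2014.IsKolyvaginPrime (W.conductorNorm ℤ) W K 2) n' →
        1 ≤ M' →
        ((θ * M' + k : ℕ) : ℕ∞) ≤ Literature.NumberTheory.EllipticCurves.Zhang2014.levelIndex W 2 n' →
        n'.primeFactors.card = ν' → d'.kolyvaginClass Nat.prime_two M' = 0 := by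
      intro ν' hν'
      have h := Nat.find_min hex hν'
      rw [not_forall] at h
      obtain ⟨θ, h⟩ := h
      rw [not_forall] at h
      obtain ⟨k, hθk⟩ := h
      exact ⟨θ, k, fun n' d' M' hn' hM' hle hcard ↦ by
        by_contra hne'; exact hθk ⟨n', d', M', hn', hcard, hM', hle, hne'⟩⟩
    -- the ONLY use of V2: the lower bound `ν + 1 ≤ max(c, c') = 1` forces `ν = 0`
    have hstruct := hV2 W hCM hred hns h2 K hK hne3 hne4 h2d hHN Dt β ι (Nat.find hex) hrich hbelow
    have hν : Nat.find hex = 0 := by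
      rcases hstruct with h1 | h1 <;> omega
    rw [hν] at hrich
    obtain ⟨n₀, d₀, M₀, hn₀, hν0, hM₀, -, hne₀⟩ := hrich 0 0
    have hn1 : n₀ = 1 := by
      rw [Finset.card_eq_zero, Nat.primeFactors_eq_empty] at hν0
      rcases hν0 with h0 | h1
      · exact absurd (h0 ▸ hn₀.1) not_squarefree_zero
      · exact h1
    subst hn1
    have hEK : Literature.NumberTheory.EllipticCurves.analyticRankEK W K = 1 :=
      Literature.NumberTheory.EllipticCurves.heegnerSystem_analyticRankEK_eq_one_of_kolyvaginClass_one_ne_zero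
        (hGZ W _ K) (hrec _ W K) hK rfl hHN d₀ hne₀
    rw [Literature.NumberTheory.EllipticCurves.analyticRankEK_eq_add_of hE W K,
      Literature.NumberTheory.EllipticCurves.analyticRank_eq_zero_of_entireLFunction_one_ne_zero _ hL1,
      add_zero] at hEK
    exact hEK

/-- **COMPOSITION (by name, zero hypotheses)**: the registered stubs (U1irr, the two print stubs, the cite-only printed
inputs) ⊢ the crux `OffHabitatIrredNonSurjTwoConverse` (stmt-BirchSwinnertonDyer-27123), through the landed V2irr / U2irr /
glue. -/
theorem offHabitatIrredNonSurjTwoConverse_of : OffHabitatIrredNonSurjTwoConverse :=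
  offHabitatIrredNonSurjTwoConverse_of_inputs strongNonzeroSystemAtTwoIrr_of_stubs corankLowerBoundAtTwoRichIrr_of_stubs
    stub_printedInputs.1 stub_printedInputs.2.1 stub_printedInputs.2.2.1 stub_printedInputs.2.2.2.1
    stub_printedInputs.2.2.2.2.1 stub_printedInputs.2.2.2.2.2.1 stub_printedInputs.2.2.2.2.2.2

end Summit.BirchSwinnertonDyer.BirchSwinnertonDyer.Cruxes.OffHabitatIrredNonSurjTwoConverse.KolyvaginDepthSplitInfIrr
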